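import Summits.QuantumFields.BalabanUV.Beta.FP.FFPerturbationHessWords
import Summits.QuantumFields.BalabanUV.Beta.FP.StepDefectInherit

/-!
# `BalabanUV.Beta.FP.NestedStepLawAssembly` — road «FP» for binder row D1, RULING R-FP-46 row **ASSEMBLY** (owner, gen 15; memo `N2B-DESIGN.md` v3.1 §11, statement-first):
# THE KERNEL-LEVEL STEP LAW `TP (m+1) = RP m + TP m` FROM THE FIVE NAMED ROWS — SLOT, SPLIT (`G_N = G₁ + G_c`), TRANSPORT, UNLIFT, TAD — the WORDS being leaf-06's
# `FFPerturbationHessWords.hessKer_add_kernel_words`; hence `StepDefectInherit.defect TP RP m = 0` and the END's `hSDF` in EVERY channel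

HONEST DEPENDENCY (page 1, mandatory): continuum YM on T⁴ ⇐ BetaPertH ∧ nine spine estimates (0/9 proved); BetaPertH ⇐ (D1) ∧ (D4) ∧ CAP+tail;
G-an2-4 gates asym, D1 and NE2/3/4.  HONEST FRAMING (cell contract, verbatim): «discharging `BetaPertH` makes Bałaban's UV stability UNCONDITIONAL —
a real constructive-QFT result; it is NOT the continuum limit and NOT the Clay problem.»  THIS MODULE is [our object] COMPOSITION BY NAME over ABSTRACT letters: the
five rows of the W-ORACLE-K architecture enter as HYPOTHESES (each is a swarm row with a named first refusal; the MODEL of every one of them is kernel-checked: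
`FP/NestedDressingHessian` ✓, `FP/EffectiveFormJets` ✓, `FP/TadpoleFree(Vertex)` ✓), the trace words are leaf-06's theorem; no `def`, no `def … : Prop`, nothing cited,
0 sorry.  It DISCHARGES NOTHING by itself: 0∕4 row-D1 binders; NOT SDF for the literal until the five rows land at the perfect objects, NOT D1, NOT BetaPertH, NOT
continuum, NOT Clay.  «not in print; our bookkeeping».

ABSOLUTE RULE (cell charter, verbatim): «No internally-minted statement may enter as a cited fact. Every hypothesis is either kernel-proved in this package or a
verbatim quotation of a PUBLISHED theorem with page reference. The manuscript(s) under audit are NOT citable for their own disputed steps — they are the thing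
under adjudication; programme-internal (2001/route/tribunal) claims are never citable.»

THE SHAPE (memo §11; level `m+1`, coarse lattice `N′`).  For each `m ≥ 1` the END's one-loop kernel `TP (m+1)` is first rewritten (ROW SLOT, `hslot`) as
`hessKer (G₁ m + Gc m) (V m) (W m)` — the dressed resolvent with the outer dressing moved off the jets —, then leaf-06's `hessKer_add_kernel_words` splits it
into the `G₁`-words and the `Gc`-words (the decay ∕ localisation letters `hG₁ hGc hV hW` at one common rate make every trace absolutely convergent); ROW TRANSPORT
(`htransport`) says the `G₁`-words are the END's transported one-step kernel `RP m` PLUS the tadpole cross term `CROSS m` (an2's `dF₁ ∘ d²U^c_m`, X-an2-54 ∕ E-FP-15-1);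
ROW UNLIFT (`hunlift`) says the `Gc`-words are the m-fold kernel `TP m` (un-lifting + the coarse tables of `EffectiveFormJets`); ROW TAD (`htad`) kills `CROSS m`
(`TadpoleFreeVertex`).  CONCLUSION: `TP (m+1) = RP m + TP m` pointwise, `defect TP RP m = 0`, and `secondMoment (defect TP RP m) μ ν = 0` for EVERY `μ ν` — the END's
`hSDF` (`RoadLeftAssemblySDF` ∕ `StepLawLeft`) with four named rows in place of one opaque binder.

CONTENTS: `stepLaw_kernel_of_rows` (pointwise step law), `defect_eq_zero_of_rows`, `secondMoment_defect_eq_zero_of_rows` (the `hSDF` shape, all channels).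
Provenance: road FP OWNER b2b-balaban-beta-d1-p3 gen 15 (prover-b2b-balaban-beta-d1-p3-g15-0), 2026-08-21; RULING R-FP-46 ∕ memo §11.  GENERIC `D`, fibre `F`, blocking `N`.
-/

noncomputable section

namespace Summit.QuantumFields.BalabanUV.Beta.FP.NestedStepLawAssembly

open Literature.MathematicalPhysics.QuantumFieldTheory.Balaban1983to89
open Literature.MathematicalPhysics.QuantumFieldTheory.Balaban1983to89.Beta
open ExpKernelCalculus (MKer comp tr tadpole bubble hessKer Decays VertexFamily VertexFamily₂)
open Summit.QuantumFields.BalabanUV.Beta.FP.FFPerturbationHessWords (hessKer_add_kernel_words)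
open Summit.QuantumFields.BalabanUV.Beta.FP.StepDefectInherit (defect)

variable {D : ℕ} {F : Type*} [Fintype F]

/-- [our object] **THE KERNEL-LEVEL STEP LAW FROM THE FIVE ROWS** (generic `D`, fibre, blockings `N m`).  Data per `m`: the dressed one-step resolvent `G₁ m`, the dressed
transported m-fold resolvent `Gc m`, the jets `V m`, `W m` (all with decay ∕ localisation letters at one rate `δ m > 0`), the END's kernels `TP`, `RP`, and the cross term
`CROSS`.  Rows: `hslot` (`TP (m+1) = hessKer (G₁ m + Gc m) (V m) (W m)`), `htransport` (the `G₁`-words `= RP m + CROSS m`), `hunlift` (the `Gc`-words `= TP m`), `htad`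
(`CROSS m = 0`).  CONCLUSION: `TP (m+1) a b z = RP m a b z + TP m a b z`. -/
theorem stepLaw_kernel_of_rows {TP RP CROSS : ℕ → Fin D → Fin D → (Fin D → ℤ) → ℝ}
    {G₁ Gc : ℕ → MKer D F} {V : ℕ → Fin D → (Fin D → ℤ) → MKer D F} {W : ℕ → Fin D → (Fin D → ℤ) → Fin D → (Fin D → ℤ) → MKer D F}
    {N : ℕ → ℕ} {C₁ Cc Cv Cw δ : ℕ → ℝ}
    (hG₁ : ∀ m, 1 ≤ m → Decays (G₁ m) (C₁ m) (δ m)) (hGc : ∀ m, 1 ≤ m → Decays (Gc m) (Cc m) (δ m))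
    (hV : ∀ m, 1 ≤ m → VertexFamily (V m) (N m) (Cv m) (δ m)) (hW : ∀ m, 1 ≤ m → VertexFamily₂ (W m) (N m) (Cw m) (δ m)) (hδ : ∀ m, 1 ≤ m → 0 < δ m)
    (hslot : ∀ m, 1 ≤ m → ∀ a b z, TP (m + 1) a b z = hessKer (G₁ m + Gc m) (V m) (W m) a b z)
    (htransport : ∀ m, 1 ≤ m → ∀ a b z, hessKer (G₁ m) (V m) (W m) a b z = RP m a b z + CROSS m a b z)
    (hunlift : ∀ m, 1 ≤ m → ∀ a b z,
      (1 / 2 : ℝ) * tadpole (Gc m) (W m a 0 b z)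
        - (1 / 2 : ℝ) * (tr (comp (comp (G₁ m) (V m a 0)) (comp (Gc m) (V m b z))) + tr (comp (comp (Gc m) (V m a 0)) (comp (G₁ m) (V m b z)))
            + bubble (Gc m) (V m a 0) (V m b z)) = TP m a b z)
    (htad : ∀ m, 1 ≤ m → ∀ a b z, CROSS m a b z = 0)
    {m : ℕ} (hm : 1 ≤ m) (a b : Fin D) (z : Fin D → ℤ) :
    TP (m + 1) a b z = RP m a b z + TP m a b z := by
  have hwords := hessKer_add_kernel_words (hG₁ m hm) (hGc m hm) (hV m hm) (hW m hm) (hW m hm) (hδ m hm) a b z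
  rw [hslot m hm a b z, hwords, sub_self, htransport m hm a b z, htad m hm a b z, ← hunlift m hm a b z]
  have h0 : tadpole (G₁ m + Gc m) (0 : MKer D F) = 0 := by
    unfold ExpKernelCalculus.tadpole ExpKernelCalculus.tr ExpKernelCalculus.comp
    simp
  rw [h0]
  ring

/-- [our object] **THE EXPLICIT FIXED-POINT DEFECT VANISHES AS A KERNEL** under the five rows: `StepDefectInherit.defect TP RP m = 0` for every `m ≥ 1`. -/
theorem defect_eq_zero_of_rows {TP RP CROSS : ℕ → Fin 4 → Fin 4 → (Fin 4 → ℤ) → ℝ}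
    {G₁ Gc : ℕ → MKer 4 F} {V : ℕ → Fin 4 → (Fin 4 → ℤ) → MKer 4 F} {W : ℕ → Fin 4 → (Fin 4 → ℤ) → Fin 4 → (Fin 4 → ℤ) → MKer 4 F}
    {N : ℕ → ℕ} {C₁ Cc Cv Cw δ : ℕ → ℝ}
    (hG₁ : ∀ m, 1 ≤ m → Decays (G₁ m) (C₁ m) (δ m)) (hGc : ∀ m, 1 ≤ m → Decays (Gc m) (Cc m) (δ m))
    (hV : ∀ m, 1 ≤ m → VertexFamily (V m) (N m) (Cv m) (δ m)) (hW : ∀ m, 1 ≤ m → VertexFamily₂ (W m) (N m) (Cw m) (δ m)) (hδ : ∀ m, 1 ≤ m → 0 < δ m)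
    (hslot : ∀ m, 1 ≤ m → ∀ a b z, TP (m + 1) a b z = hessKer (G₁ m + Gc m) (V m) (W m) a b z)
    (htransport : ∀ m, 1 ≤ m → ∀ a b z, hessKer (G₁ m) (V m) (W m) a b z = RP m a b z + CROSS m a b z)
    (hunlift : ∀ m, 1 ≤ m → ∀ a b z,
      (1 / 2 : ℝ) * tadpole (Gc m) (W m a 0 b z)
        - (1 / 2 : ℝ) * (tr (comp (comp (G₁ m) (V m a 0)) (comp (Gc m) (V m b z))) + tr (comp (comp (Gc m) (V m a 0)) (comp (G₁ m) (V m b z)))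
            + bubble (Gc m) (V m a 0) (V m b z)) = TP m a b z)
    (htad : ∀ m, 1 ≤ m → ∀ a b z, CROSS m a b z = 0)
    {m : ℕ} (hm : 1 ≤ m) : defect TP RP m = 0 := by
  funext a b z
  show TP (m + 1) a b z - RP m a b z - TP m a b z = 0
  rw [stepLaw_kernel_of_rows hG₁ hGc hV hW hδ hslot htransport hunlift htad hm a b z]
  ring

/-- [our object] **THE END's `hSDF` SHAPE, EVERY CHANNEL** under the five rows: `B12Beta.secondMoment (defect TP RP m) μ ν = 0` for all `m ≥ 1`, `μ`, `ν` — the binder of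
`RoadLeftAssemblySDF.d1Drift_left_of_sliceLedger_sdf` ∕ `StepLawLeft.stepLaw_left_of_ward_symm_explicitDefect` with SLOT ∕ TRANSPORT ∕ UNLIFT ∕ TAD in place of one opaque hypothesis. -/
theorem secondMoment_defect_eq_zero_of_rows {TP RP CROSS : ℕ → Fin 4 → Fin 4 → (Fin 4 → ℤ) → ℝ}
    {G₁ Gc : ℕ → MKer 4 F} {V : ℕ → Fin 4 → (Fin 4 → ℤ) → MKer 4 F} {W : ℕ → Fin 4 → (Fin 4 → ℤ) → Fin 4 → (Fin 4 → ℤ) → MKer 4 F}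
    {N : ℕ → ℕ} {C₁ Cc Cv Cw δ : ℕ → ℝ}
    (hG₁ : ∀ m, 1 ≤ m → Decays (G₁ m) (C₁ m) (δ m)) (hGc : ∀ m, 1 ≤ m → Decays (Gc m) (Cc m) (δ m))
    (hV : ∀ m, 1 ≤ m → VertexFamily (V m) (N m) (Cv m) (δ m)) (hW : ∀ m, 1 ≤ m → VertexFamily₂ (W m) (N m) (Cw m) (δ m)) (hδ : ∀ m, 1 ≤ m → 0 < δ m)
    (hslot : ∀ m, 1 ≤ m → ∀ a b z, TP (m + 1) a b z = hessKer (G₁ m + Gc m) (V m) (W m) a b z)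
    (htransport : ∀ m, 1 ≤ m → ∀ a b z, hessKer (G₁ m) (V m) (W m) a b z = RP m a b z + CROSS m a b z)
    (hunlift : ∀ m, 1 ≤ m → ∀ a b z,
      (1 / 2 : ℝ) * tadpole (Gc m) (W m a 0 b z)
        - (1 / 2 : ℝ) * (tr (comp (comp (G₁ m) (V m a 0)) (comp (Gc m) (V m b z))) + tr (comp (comp (Gc m) (V m a 0)) (comp (G₁ m) (V m b z)))
            + bubble (Gc m) (V m a 0) (V m b z)) = TP m a b z)
    (htad : ∀ m, 1 ≤ m → ∀ a b z, CROSS m a b z = 0) :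
    ∀ m : ℕ, 1 ≤ m → ∀ μ ν : Fin 4, B12Beta.secondMoment (defect TP RP m) μ ν = 0 := by
  intro m hm μ ν
  rw [defect_eq_zero_of_rows hG₁ hGc hV hW hδ hslot htransport hunlift htad hm]
  simp [B12Beta.secondMoment]

end Summit.QuantumFields.BalabanUV.Beta.FP.NestedStepLawAssembly

end
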